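import Summits.AnomalousDissipation.AnomalousDissipation.Theses.TwoAndHalfD
import Literature.Analysis.FluidPDE.TwoHalfNavierStokes
import Literature.Analysis.FluidPDE.LongTimeAverageNonneg
import Literature.Analysis.FluidPDE.TwoHalfLerayHopfDescent
import Literature.Analysis.FluidPDE.LerayHopfUniformEnergyMomentum
import Literature.Analysis.FluidPDE.LongTimeAverageSubadditive
import Literature.Analysis.FluidPDE.LerayHopfSpectralMeasurability

/-!
# Stub `stub_reductionOffZero` (S1') of the line `log-kantorovich-enstrophy-transfer` for the
# crux `TwoAndHalfD.TwohalfdNeg` (stmt-AnomalousDissipation-0211): the `x₃`-invariant reduction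

An `x₃`-invariant global Leray–Hopf family on `T³` under an `x₃`-invariant steady smooth force IS
a `2½`-dimensional pair with split budgets: `f = twoHalf g h` and, for `t ≠ 0`,
`u_j(t) = twoHalf (v_j t) (θ_j t)`, where `v_j` is a global Leray–Hopf solution of the planar
system forced by `g` and `θ_j` a global weak solution of the sourced advection–diffusion equation
driven by `v_j` with source `h`; the planar mean energy and the scalar mean variance are bounded
by the three-dimensional mean energy, and the mean dissipation sub-splits.

Proof. The sections and their regularity are the tree's `2½`-dimensional bookkeeping
(`TwoHalfSection`, `TwoHalfSpectralSplit`, `TwoHalfWeakSection`, `TwoHalfScalarSection`); the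
Leray–Hopf structure of the planar part is the descent theorem
`Torus.IsGlobalLerayHopf.twoHalf_descent` (`TwoHalfLerayHopfDescent`), whose energy inequalities
come from the two-dimensional energy EQUALITY of weak solutions in the energy class
(Lions–Prodi; `NSEnergyClassSlice` → `NSEnergyClassLevelN` → `NSEnergyClassEnergyEquality` →
`NSEnergyEquality2D`, the Leray–Hopf-keyed Lions–Shinbrot argument of
`DuchonRobertLionsEnergyEquality` re-run on unbundled hypotheses), after replacing the arbitrary
datum of the structure by its honest invariant representative (`LerayHopfDatumTorus`) and
resetting the free slice `t = 0` of the planar section to that datum (conjunct 7 holds for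
`t ≠ 0` only: the registered everywhere-form is refuted, `Negative.ReductionSliceZero`). The
mean bounds are monotonicity/subadditivity of `limsup` Cesàro means
(`LongTimeAverageSubadditive`) fed with the honest bounds of `LerayHopfUniformEnergyMomentum` /
`LerayHopfMomentum` (momentum bookkeeping uses `∫ f = 0`). Supports stmt-AnomalousDissipation-0211.
-/

namespace Summit.AnomalousDissipation.AnomalousDissipation.Theorems.TwohalfdNeg.ReductionOffZero

open MeasureTheory Filter Topology Set
open scoped ENNReal NNReal
open Literature.Analysis.FunctionSpaces Literature.Analysis.FluidPDE

set_option linter.dupNamespace false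

/-! ## Local integrability and means along a global Leray–Hopf solution -/

section Means

variable {d : Type} [Fintype d] [DecidableEq d] {ν : ℝ} {F u₀ : UnitAddTorus d → EuclideanSpace ℝ d}
  {u : ℝ → UnitAddTorus d → EuclideanSpace ℝ d}

/-- The energy `t ↦ ∫‖u t‖²` of a global Leray–Hopf solution with a steady `L²` force is
integrable on every `(0, T]` (jointly measurable, bounded on `[0, T]` by the energy inequality). [folklore] -/
theorem integrableOn_integral_norm_sq (hν : 0 < ν) (hF : MemLp F 2 volume)
    (hu : Torus.IsGlobalLerayHopf ν (fun _ => F) u₀ u) {T : ℝ} (hT : 0 < T) :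
    IntegrableOn (fun t => ∫ x, ‖u t x‖ ^ 2) (Ioc 0 T) := by
  have H := hu T hT
  obtain ⟨M, hM, hbound⟩ := H.exists_forall_lintegral_enorm_sq_le hν.le
    (Torus.aestronglyMeasurable_stLift_steady hF.1 _) (Torus.lintegral_enorm_sq_steady_lt_top' hF T)
  have hmeas : AEStronglyMeasurable (fun t => ∫ x, ‖u t x‖ ^ 2) (volume.restrict (Ioo 0 T)) := by
    have h1 : AEStronglyMeasurable (fun p : ℝ × UnitAddTorus d => ‖Function.uncurry u p‖ ^ 2)
        ((volume.restrict (Ioo 0 T)).prod volume) :=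
      (continuous_pow 2).comp_aestronglyMeasurable H.aestronglyMeasurable_uncurry.norm
    exact h1.integral_prod_right'
  rw [IntegrableOn, ← Measure.restrict_congr_set Ioo_ae_eq_Ioc]
  have : IsFiniteMeasure (volume.restrict (Ioo (0 : ℝ) T)) := ⟨by
    rw [Measure.restrict_apply_univ]; exact measure_Ioo_lt_top⟩
  refine ⟨hmeas, HasFiniteIntegral.of_bounded (C := M.toReal) ?_⟩
  filter_upwards [ae_restrict_mem measurableSet_Ioo] with t ht
  have hmem : MemLp (u t) 2 volume := H.memLp t (Ioo_subset_Icc_self ht)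
  rw [Real.norm_eq_abs, abs_of_nonneg (integral_nonneg fun x => sq_nonneg _),
    Torus.integral_norm_sq_eq_toReal_lintegral hmem]
  exact ENNReal.toReal_mono hM (hbound t (Ioo_subset_Icc_self ht))

/-- The dissipation `t ↦ ν‖∇u t‖₂²` of a global Leray–Hopf solution is integrable on every
`(0, T]`. [folklore] -/
theorem integrableOn_dissipation (hu : Torus.IsGlobalLerayHopf ν (fun _ => F) u₀ u) {T : ℝ} (hT : 0 < T) :
    IntegrableOn (fun t => ν * (Torus.eGradNormSq (u t)).toReal) (Ioc 0 T) := by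
  have H := hu T hT
  rw [IntegrableOn, ← Measure.restrict_congr_set Ioo_ae_eq_Ioc]
  exact (integrable_toReal_of_lintegral_ne_top H.aemeasurable_eGradNormSq H.lintegral_eGradNormSq_lt_top.ne).const_mul ν

/-- **Bounded observables have bounded long-time means**: if `0 ≤ a t ≤ ∫‖u t‖²` for `t > 0`
along a global Leray–Hopf solution with steady mean-zero `L²` force, then
`⟨a⟩ ≤ ⟨‖u‖²⟩ = meanEnergy u` (`longTimeAvgSup_mono`, the uniform-in-time energy bound). [folklore] -/
theorem longTimeAvgSup_le_meanEnergy (hν : 0 < ν) (hF : MemLp F 2 volume) (hF0 : Torus.HasZeroMean F)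
    (hu : Torus.IsGlobalLerayHopf ν (fun _ => F) u₀ u) {a : ℝ → ℝ} (ha0 : ∀ t, 0 ≤ a t)
    (hle : ∀ t, 0 < t → a t ≤ ∫ x, ‖u t x‖ ^ 2) :
    longTimeAvgSup a ≤ meanEnergy u := by
  rw [meanEnergy_eq_longTimeAvgSup]
  exact longTimeAvgSup_mono ha0 (fun t => integral_nonneg fun x => sq_nonneg _)
    (fun T hT => integrableOn_integral_norm_sq hν hF hu hT) hle (hu.isBoundedUnder_timeMean_energy hν hF hF0)

end Means

/-! ## The budgets of a `2½`-dimensional pair -/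

section Budgets

variable {ν : ℝ} {f u₀ : UnitAddTorus (Fin 3) → EuclideanSpace ℝ (Fin 3)}
  {u : ℝ → UnitAddTorus (Fin 3) → EuclideanSpace ℝ (Fin 3)}
  {v₀ : UnitAddTorus (Fin 2) → EuclideanSpace ℝ (Fin 2)}

variable (hν : 0 < ν) (hf : MemLp f 2 volume) (hfz : Torus.HasZeroMean f)
  (hLH : Torus.IsGlobalLerayHopf ν (fun _ => f) u₀ u)
  (huinv : ∀ (t : ℝ) (s : UnitAddCircle) (x : UnitAddTorus (Fin 3)), u t (x + Pi.single (2 : Fin 3) s) = u t x)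
include hν hf hfz hLH huinv

/-- **The planar mean energy is bounded by the three-dimensional one** (`∫‖u‖² = ∫‖v‖² + ∫θ²`
slice-wise for `t > 0`; the slice `t = 0` is invisible to the means). [folklore] -/
theorem meanEnergy_planar_le :
    meanEnergy (Function.update (fun t y => Torus.planarProjE (u t (Torus.planarSect y))) 0 v₀) ≤ meanEnergy u := by
  set V : ℝ → UnitAddTorus (Fin 2) → EuclideanSpace ℝ (Fin 2) := fun t y => Torus.planarProjE (u t (Torus.planarSect y)) with hV
  set Θ : ℝ → UnitAddTorus (Fin 2) → ℝ := fun t y => u t (Torus.planarSect y) 2 with hΘ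
  have hue : ∀ t, u t = Torus.twoHalf (V t) (Θ t) := fun t => Torus.eq_twoHalf_of_forall_add_single' (huinv t)
  rw [meanEnergy_eq_longTimeAvgSup]
  refine longTimeAvgSup_le_meanEnergy hν hf hfz hLH (fun t => integral_nonneg fun x => sq_nonneg _) fun t ht => ?_
  have hs := Torus.IsGlobalLerayHopf.memLp_sections hLH huinv ht.le
  rw [Function.update_of_ne ht.ne']
  calc ∫ y, ‖V t y‖ ^ 2 ≤ (∫ y, ‖V t y‖ ^ 2) + ∫ y, Θ t y ^ 2 :=
        le_add_of_nonneg_right (integral_nonneg fun y => sq_nonneg _)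
    _ = ∫ x, ‖Torus.twoHalf (V t) (Θ t) x‖ ^ 2 := (Torus.integral_norm_sq_twoHalf_of_memLp hs.1 hs.2).symm
    _ = ∫ x, ‖u t x‖ ^ 2 := by rw [← hue t]

/-- **The scalar mean variance is bounded by the three-dimensional mean energy.** [folklore] -/
theorem longTimeAvgSup_scalarL2Sq_le :
    longTimeAvgSup (fun t => Torus.scalarL2Sq (fun y => u t (Torus.planarSect y) 2)) ≤ meanEnergy u := by
  set V : ℝ → UnitAddTorus (Fin 2) → EuclideanSpace ℝ (Fin 2) := fun t y => Torus.planarProjE (u t (Torus.planarSect y)) with hV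
  set Θ : ℝ → UnitAddTorus (Fin 2) → ℝ := fun t y => u t (Torus.planarSect y) 2 with hΘ
  have hue : ∀ t, u t = Torus.twoHalf (V t) (Θ t) := fun t => Torus.eq_twoHalf_of_forall_add_single' (huinv t)
  refine longTimeAvgSup_le_meanEnergy hν hf hfz hLH (fun t => integral_nonneg fun y => sq_nonneg _) fun t ht => ?_
  have hs := Torus.IsGlobalLerayHopf.memLp_sections hLH huinv ht.le
  show ∫ y, Θ t y ^ 2 ≤ ∫ x, ‖u t x‖ ^ 2
  calc ∫ y, Θ t y ^ 2 ≤ (∫ y, ‖V t y‖ ^ 2) + ∫ y, Θ t y ^ 2 :=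
        le_add_of_nonneg_left (integral_nonneg fun y => sq_nonneg _)
    _ = ∫ x, ‖Torus.twoHalf (V t) (Θ t) x‖ ^ 2 := (Torus.integral_norm_sq_twoHalf_of_memLp hs.1 hs.2).symm
    _ = ∫ x, ‖u t x‖ ^ 2 := by rw [← hue t]

/-- **The mean dissipation sub-splits**: `⟨ν‖∇u‖²⟩ ≤ ⟨ν‖∇v‖²⟩ + ⟨ν‖∇θ‖²⟩` — slice-wise
`‖∇u‖₂² = ‖∇v‖₂² + ‖∇θ‖₂²` spectrally (`Torus.eGradNormSq_twoHalf`), `toReal` is subadditive,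
and the `limsup` Cesàro means are subadditive for nonnegative locally integrable observables with
bounded means (`longTimeAvgSup_le_add_of_le_add`; the means of `ν‖∇v‖²` and `ν‖∇θ‖² ≤ ν‖∇u‖²`
are bounded by the energy inequalities of `v` and `u`). [folklore] -/
theorem meanDissipation_le_add {g : UnitAddTorus (Fin 2) → EuclideanSpace ℝ (Fin 2)} (hg : MemLp g 2 volume)
    (hgz : Torus.HasZeroMean g)
    (hv : Torus.IsGlobalLerayHopf ν (fun _ => g) v₀
      (Function.update (fun t y => Torus.planarProjE (u t (Torus.planarSect y))) 0 v₀)) :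
    meanDissipation ν u ≤
      meanDissipation ν (Function.update (fun t y => Torus.planarProjE (u t (Torus.planarSect y))) 0 v₀) +
        longTimeAvgSup (fun t => ν * (Torus.eScalarGradNormSq (fun y => u t (Torus.planarSect y) 2)).toReal) := by
  set V : ℝ → UnitAddTorus (Fin 2) → EuclideanSpace ℝ (Fin 2) := fun t y => Torus.planarProjE (u t (Torus.planarSect y)) with hV
  set Θ : ℝ → UnitAddTorus (Fin 2) → ℝ := fun t y => u t (Torus.planarSect y) 2 with hΘ
  set v := Function.update V 0 v₀ with hvdef
  have hue : ∀ t, u t = Torus.twoHalf (V t) (Θ t) := fun t => Torus.eq_twoHalf_of_forall_add_single' (huinv t)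
  have hvt : ∀ t, 0 < t → v t = V t := fun t ht => Function.update_of_ne ht.ne' _ _
  have hint : ∀ t, 0 ≤ t → Integrable (V t) volume ∧ Integrable (Θ t) volume := fun t ht =>
    ⟨(Torus.IsGlobalLerayHopf.memLp_sections hLH huinv ht).1.integrable one_le_two,
      (Torus.IsGlobalLerayHopf.memLp_sections hLH huinv ht).2.integrable one_le_two⟩
  have hν0 := hν.le
  -- slice-wise: the split, `‖∇θ‖² ≤ ‖∇u‖²`, and the sub-split of `toReal`
  have hsplit : ∀ t, 0 ≤ t → Torus.eGradNormSq (u t) = Torus.eGradNormSq (V t) + Torus.eScalarGradNormSq (Θ t) := by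
    intro t ht
    rw [← Torus.eGradNormSq_twoHalf (hint t ht).1 (hint t ht).2, ← hue t]
  have hΘle : ∀ t, 0 ≤ t → Torus.eScalarGradNormSq (Θ t) ≤ Torus.eGradNormSq (u t) := fun t ht => by
    rw [hsplit t ht]; exact le_add_self
  have hreal : ∀ t, 0 < t → (Torus.eGradNormSq (u t)).toReal ≤
      (Torus.eGradNormSq (v t)).toReal + (Torus.eScalarGradNormSq (Θ t)).toReal := fun t ht => by
    rw [hsplit t ht.le, hvt t ht]; exact ENNReal.toReal_add_le
  -- local integrability of the scalar dissipation on every `(0, T]`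
  have hgi : ∀ T, 0 < T → IntegrableOn (fun t => ν * (Torus.eScalarGradNormSq (Θ t)).toReal) (Ioc 0 T) := by
    intro T hT
    have Hu := hLH T hT
    have Hv := hv T hT
    have hvfin : ∀ᵐ t ∂(volume.restrict (Ioo 0 T)), Torus.eGradNormSq (v t) < ⊤ :=
      ae_lt_top' Hv.aemeasurable_eGradNormSq Hv.lintegral_eGradNormSq_lt_top.ne
    have hmeas : AEMeasurable (fun t => Torus.eScalarGradNormSq (Θ t)) (volume.restrict (Ioo 0 T)) := by
      refine (Hu.aemeasurable_eGradNormSq.sub Hv.aemeasurable_eGradNormSq).congr ?_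
      filter_upwards [hvfin, ae_restrict_mem measurableSet_Ioo] with t hfin ht
      show Torus.eGradNormSq (u t) - Torus.eGradNormSq (v t) = Torus.eScalarGradNormSq (Θ t)
      rw [hvt t ht.1] at hfin
      rw [hsplit t ht.1.le, hvt t ht.1]
      exact ENNReal.add_sub_cancel_left hfin.ne
    have hfin : ∫⁻ t in Ioo 0 T, Torus.eScalarGradNormSq (Θ t) ≠ ⊤ :=
      ((setLIntegral_mono' measurableSet_Ioo fun t ht => hΘle t ht.1.le).trans_lt Hu.lintegral_eGradNormSq_lt_top).ne
    rw [IntegrableOn, ← Measure.restrict_congr_set Ioo_ae_eq_Ioc]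
    exact (integrable_toReal_of_lintegral_ne_top hmeas hfin).const_mul ν
  unfold meanDissipation
  refine longTimeAvgSup_le_add_of_le_add (fun t => mul_nonneg hν0 ENNReal.toReal_nonneg)
    (fun t => mul_nonneg hν0 ENNReal.toReal_nonneg) (fun t => mul_nonneg hν0 ENNReal.toReal_nonneg)
    (fun T hT => integrableOn_dissipation hv hT) hgi (hv.isBoundedUnder_timeMean_dissipation hν hg hgz) ?_ fun t ht => ?_
  · -- bounded means of the scalar dissipation: a.e. below those of `u`
    obtain ⟨M, hM⟩ := hLH.isBoundedUnder_timeMean_dissipation hν hf hfz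
    rw [Filter.eventually_map] at hM
    refine ⟨M, ?_⟩
    rw [Filter.eventually_map]
    filter_upwards [hM, eventually_gt_atTop (0 : ℝ)] with T hTM hT
    refine le_trans ?_ hTM
    have Hu := hLH T hT
    have hufin : ∀ᵐ t ∂(volume.restrict (Ioc 0 T)), Torus.eGradNormSq (u t) < ⊤ := by
      rw [← Measure.restrict_congr_set Ioo_ae_eq_Ioc]
      exact ae_lt_top' Hu.aemeasurable_eGradNormSq Hu.lintegral_eGradNormSq_lt_top.ne
    unfold timeMean
    rw [intervalIntegral.integral_of_le hT.le, intervalIntegral.integral_of_le hT.le]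
    refine mul_le_mul_of_nonneg_left (integral_mono_ae (hgi T hT) (integrableOn_dissipation hLH hT) ?_) (inv_nonneg.2 hT.le)
    filter_upwards [hufin, ae_restrict_mem measurableSet_Ioc] with t hfin ht
    exact mul_le_mul_of_nonneg_left (ENNReal.toReal_mono hfin.ne (hΘle t ht.1.le)) hν0
  · -- the pointwise sub-split for `t > 0`
    show ν * (Torus.eGradNormSq (u t)).toReal ≤ ν * (Torus.eGradNormSq (v t)).toReal + ν * (Torus.eScalarGradNormSq (Θ t)).toReal
    rw [← mul_add]
    exact mul_le_mul_of_nonneg_left (hreal t ht) hν0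

end Budgets

/-! ## The stub -/

/-- **S1' `stub_reductionOffZero` — an `x₃`-invariant Leray–Hopf family under an `x₃`-invariant
steady force IS a `2½`-dimensional pair, with split budgets; the pointwise split for `t ≠ 0`.**
`g`, `h` are the planar and vertical sections of `f`; `v_j` is the planar section of `u_j`
re-defined at `t = 0` by the planar section of the honest invariant representative of the datum
(a global Leray–Hopf solution of the planar system by the `2½`-dimensional descent theorem
`Torus.IsGlobalLerayHopf.twoHalf_descent`, whose energy inequalities are the two-dimensional
energy equality in the energy class, Lions–Prodi 1959); `θ_j` is the vertical section of `u_j`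
(a global weak sourced scalar driven by `v_j`); the planar mean energy and the scalar mean
variance are bounded by `meanEnergy (u j)` slice-wise, and the mean dissipation sub-splits by the
spectral identity `‖∇u‖² = ‖∇v‖² + ‖∇θ‖²` and subadditivity of `limsup` Cesàro means. -/
theorem stub_reductionOffZero :
    ∀ f : UnitAddTorus (Fin 3) → EuclideanSpace ℝ (Fin 3),
      (∀ (s : UnitAddCircle) (x : UnitAddTorus (Fin 3)), f (x + Pi.single (2 : Fin 3) s) = f x) →
      Torus.IsSmooth f → Torus.IsDivFree f → Torus.HasZeroMean f →
      ∀ (ν : ℕ → ℝ) (u₀ : ℕ → UnitAddTorus (Fin 3) → EuclideanSpace ℝ (Fin 3))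
        (u : ℕ → ℝ → UnitAddTorus (Fin 3) → EuclideanSpace ℝ (Fin 3)),
        (∀ j, 0 < ν j) →
        (∀ j, Torus.IsGlobalLerayHopf (ν j) (fun _ => f) (u₀ j) (u j)) →
        (∀ j (t : ℝ) (s : UnitAddCircle) (x : UnitAddTorus (Fin 3)),
          u j t (x + Pi.single (2 : Fin 3) s) = u j t x) →
        (∃ E : ℝ, ∀ j, meanEnergy (u j) ≤ E) →
        ∃ (g : UnitAddTorus (Fin 2) → EuclideanSpace ℝ (Fin 2)) (h : UnitAddTorus (Fin 2) → ℝ)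
          (v₀ : ℕ → UnitAddTorus (Fin 2) → EuclideanSpace ℝ (Fin 2))
          (v : ℕ → ℝ → UnitAddTorus (Fin 2) → EuclideanSpace ℝ (Fin 2))
          (θ₀ : ℕ → UnitAddTorus (Fin 2) → ℝ) (θ : ℕ → ℝ → UnitAddTorus (Fin 2) → ℝ),
          Torus.IsSmooth g ∧ Torus.IsDivFree g ∧ Torus.HasZeroMean g ∧
          Torus.IsSmooth h ∧ Torus.HasZeroMean h ∧
          f = Torus.twoHalf g h ∧ (∀ j (t : ℝ), t ≠ 0 → u j t = Torus.twoHalf (v j t) (θ j t)) ∧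
          (∀ j, Torus.IsGlobalLerayHopf (ν j) (fun _ => g) (v₀ j) (v j)) ∧
          (∀ j, MemLp (θ₀ j) 2 volume) ∧
          (∀ j, Torus.IsWeakScalarTransportForced (ν j) (v j) (fun _ => h) (θ₀ j) (θ j)) ∧
          (∃ E : ℝ, ∀ j, meanEnergy (v j) ≤ E) ∧
          (∃ E : ℝ, ∀ j, longTimeAvgSup (fun t => Torus.scalarL2Sq (θ j t)) ≤ E) ∧
          (∀ j, meanDissipation (ν j) (u j) ≤
            meanDissipation (ν j) (v j) +
              longTimeAvgSup (fun t => ν j * (Torus.eScalarGradNormSq (θ j t)).toReal)) := by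
  intro f hfinv hfs hfd hfz ν u₀ u hν hLH huinv hE
  -- the sections of the force
  set g : UnitAddTorus (Fin 2) → EuclideanSpace ℝ (Fin 2) := fun y => Torus.planarProjE (f (Torus.planarSect y)) with hg
  set h : UnitAddTorus (Fin 2) → ℝ := fun y => f (Torus.planarSect y) 2 with hh
  have hfe : f = Torus.twoHalf g h := Torus.eq_twoHalf_of_forall_add_single' hfinv
  have hfs' : Torus.IsSmooth (Torus.twoHalf g h) := hfe ▸ hfs
  have hgs : Torus.IsSmooth g := Torus.isSmooth_left_of_twoHalf hfs'
  have hhs : Torus.IsSmooth h := Torus.isSmooth_right_of_twoHalf hfs'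
  have hgd : Torus.IsDivFree g := Torus.isDivFree_of_twoHalf (hfe ▸ hfd)
  have hz : Torus.HasZeroMean g ∧ Torus.HasZeroMean h :=
    Torus.hasZeroMean_of_twoHalf ((hgs.memLp 2).integrable one_le_two) ((hhs.memLp 2).integrable one_le_two) (hfe ▸ hfz)
  have hfL2 : MemLp f 2 volume := hfs.memLp 2
  -- the descent, solution by solution
  have hdesc := fun j => Torus.IsGlobalLerayHopf.twoHalf_descent (hν j) hfL2 hfinv (hLH j) (huinv j)
  choose v₀ θ₀ hv₀ hθ₀ hvLH hθw using hdesc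
  obtain ⟨E, hEu⟩ := hE
  refine ⟨g, h, v₀, fun j => Function.update (fun t y => Torus.planarProjE (u j t (Torus.planarSect y))) 0 (v₀ j), θ₀,
    fun j t y => u j t (Torus.planarSect y) 2, hgs, hgd, hz.1, hhs, hz.2, hfe, fun j t ht => ?_, hvLH, hθ₀, hθw,
    ⟨E, fun j => (meanEnergy_planar_le (hν j) hfL2 hfz (hLH j) (huinv j)).trans (hEu j)⟩,
    ⟨E, fun j => (longTimeAvgSup_scalarL2Sq_le (hν j) hfL2 hfz (hLH j) (huinv j)).trans (hEu j)⟩,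
    fun j => meanDissipation_le_add (hν j) hfL2 hfz (hLH j) (huinv j) (hgs.memLp 2) hz.1 (hvLH j)⟩
  -- conjunct 7: the pointwise split off `t = 0`
  show u j t = Torus.twoHalf (Function.update (fun t y => Torus.planarProjE (u j t (Torus.planarSect y))) 0 (v₀ j) t)
    (fun y => u j t (Torus.planarSect y) 2)
  rw [Function.update_of_ne ht]
  exact Torus.eq_twoHalf_of_forall_add_single' (huinv j t)

end Summit.AnomalousDissipation.AnomalousDissipation.Theorems.TwohalfdNeg.ReductionOffZero
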